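import Literature.NumberTheory.Automorphic.Liu2021.Def411WeilCarriersSplittingDictionary
import Literature.NumberTheory.GelbartRogawski1991.UnitaryDualPairThetaKernelCMTwist
import Literature.NumberTheory.GelbartRogawski1991.UnitaryDualPairThetaKernelTwist
import Literature.NumberTheory.Automorphic.UnitaryGroupAdelicOneTorusDictionary
import Literature.NumberTheory.Automorphic.UnitaryLineArchExponents
import HarnessLib

/-!
# Rigidity of the archimedean central character along the splitting dictionary `χ ↦ ι_χ`

Topic `NumberTheory/Automorphic/Liu2021`; namespace `Literature.NumberTheory.Automorphic.Liu2021.Def411WeilCarriersDoubling`.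
KERNEL only: proved theorems and three plumbing definitions with bodies (`archUnit` ∕ `archUnitHom`: the archimedean norm-one
torus `U(1)(L⁺ ⊗ ℝ)` placed in `U(1)(𝔸_{L⁺})`; `archUnitChar`: the archimedean component of a character of `U(1)(𝔸_{L⁺})`);
no `def … : Prop`, no named fact, no `sorry`.

[GelbartRogawski1991, §3.1 Remark p. 457 L4–13]: the compatible splittings of the metaplectic cover over `G₁(𝔸) = U(𝕍)(𝔸_{L⁺})` form
ONE torsor under the automorphic characters `ν′` of `E¹ = U(1)` «regarded as a character of `G`» (through `det`), and «a choice of `s`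
is equivalent to a choice of Hecke character» — the tree's dictionary `χ ↦ ι_χ := chiSplittingLine χ` with `ι_{χ·α̃} = ι_χ ⊗ (α ∘ det)`
(`chiSplittingLine_mul_ratioHecke`) and, modulo the displayed predicate `CentralCharFactorsThroughDet` (discharged for rank 3 by
`UnitaryGroupAdelicCharactersDetPair`), `s = ι_{χ₀·α̃}` for every continuous compatible `s` (`exists_eq_chiSplittingLine_of_isCompatible`).
[Liu2021, App. D Step 2 / Def. 4.1–4.3]: `μ` enters `ω(μ, ε) = ω(ε) ∘ ι_μ` only through `ι_μ`, and its WEIGHT is a condition on `μ_∞`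
alone (Remark 4.2).  This file proves the bookkeeping that makes the ARCHIMEDEAN CENTRAL CHARACTER of a splitting on any non-zero
vector determine the archimedean component of the twisting character `α`:

* §1 arithmetic: `archWeight L (n • m) = (archWeight L m)^n`, `archWeight L (m − m') = archWeight L m / archWeight L m'`.
* §2 the archimedean centre: `archUnit t ∈ U(1)(𝔸_{L⁺})` for `t ∈ U(1)(L⁺ ⊗ ℝ)` (LITERALLY the element the COR-CM package's
  `LiuIndex.HasCentralTypeAt` feeds to `CMCenter`), every continuous `α` has an archimedean type
  (`exists_archUnitChar_eq_archWeight`), `det ((u·1_V) ⊗ 1) = u^N` on the pair group (`pairDet_pairMap_center`), and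
  **`pairRep_twist_pairDet_center`**: `ω((s ⊗ (α∘det))(u·1_V, 1)) Φ = α(u)^N • ω(s(u·1_V, 1)) Φ`.
* §3 **RIGIDITY** (`exists_eq_chiSplittingLine_archType_of_center`): for a base point `χ₀` and a continuous compatible `s` of the
  line datum, if the archimedean centre acts through `ι_{χ₀}` on some `Φ₀ ≠ 0` by `archWeight L m₀` and through `s` on the SAME
  `Φ₀` by `archWeight L m`, then `s = ι_{χ₀·α̃}` with `α|_{U(1)(L⁺⊗ℝ)} = archWeight L a` and `N • a = m − m₀`; in particular
  (`exists_eq_chiSplittingLine_archTrivial_of_center_eq`) EQUAL central characters force `α = 1` on `U(1)(L⁺ ⊗ ℝ)`;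
  §4 `…_cm`: the same at the tree's CM datum `cmSplittingDatum` (the `IsCompatible` shape of the COR-CM index), one call for the pin.

Division of labour (pub-hodgecm2 E-DEDUP, HOME/INBOX l.9510 ∕ l.9533): the Hecke-character side — `ratioHecke α` has unitary
archimedean type `2 · archType(α)`, hence `χ₀ · α̃` has the type of `χ₀` when `α_∞ = 1`, with the weight-one ∕ CM-type reading
[Liu2021, Def. 4.3] — is the leaf `Automorphic/UnitaryGroupAdelicCharactersArchType` (seat item6-p3); the sequel of this file
composes the two.  Consequence for the Δ2 bridge of the Hodge-CM cells (X3-Char item (E)): at a Gram class ONE dictionary member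
`ι_{χ₀}` of the central-type fibre with `χ₀` of the weight-one type transports its archimedean type to EVERY continuous member of
the fibre; the residual analytic input is the central character of a single reference splitting, which nothing here computes
([KonnoKonno2007, Lem. 5.2] ∕ [Liu2021, Lem. D.2] territory).  HC_CM is NOT proved here or anywhere in the tree.
References: S. Gelbart, J. Rogawski, Invent. Math. 105 (1991), §3.1 Prop. 3.1.1 p. 455, Remark p. 457 L4–13 [GelbartRogawski1991];
Y. Liu, Camb. J. Math. 9 (2021), §4.1 Def. 4.1–4.3, Remark 4.2, App. D §D.1 Step 2 [Liu2021]; M. Harris, S. Kudla, W. J. Sweet,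
J. AMS 9 (1996), §1 (1.14)–(1.15) [HarrisKudlaSweet1996]; T. Bröcker, T. tom Dieck, *Representations of Compact Lie Groups*
(1985), Ch. II Prop. 8.1 [BrockerTomDieck1985].  Provenance: pub-hodgecm2 (COR-CM), seat pin-3, X3-Char residual item (E).
-/

set_option autoImplicit false

noncomputable section

open scoped Classical
open scoped Matrix Kronecker TensorProduct
open NumberField NumberField.InfinitePlace IsDedekindDomain
open Literature.RepresentationTheory.HeisenbergGroup
open Literature.NumberTheory.Weil1964
open Literature.RepresentationTheory.HarrisKudlaSweet1996
open Literature.NumberTheory.Automorphic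
open Literature.NumberTheory.GaloisRepresentations

namespace Literature.NumberTheory.Automorphic.Liu2021.Def411WeilCarriersDoubling

open Literature.NumberTheory.GelbartRogawski1991 Literature.NumberTheory.GelbartRogawski1991.UnitaryDualPair
open Literature.NumberTheory.GelbartRogawski1991.GRConstruction
open Literature.NumberTheory.GelbartRogawski1991.GRConstruction.DoubledWeilDetTwist

variable (L : Type) [Field L] [NumberField L] [IsCMField L]

local notation3 "L⁺" => maximalRealSubfield L

/-! ## §1 Arithmetic of archimedean types -/

section Arith

/-- `archWeight L (n • m) t = (archWeight L m t) ^ n`. [cite: BrockerTomDieck1985, Ch. II Prop. 8.1] -/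
theorem archWeight_nsmul (n : ℕ) (m : InfinitePlace L → ℤ) (t : relNormOneInfUnits L⁺ L) :
    archWeight L (n • m) t = archWeight L m t ^ n := by
  induction n with
  | zero => rw [zero_smul, pow_zero, archWeight_zero]
  | succ n ih => rw [succ_nsmul, archWeight_add, ih, pow_succ]

/-- `archWeight L (m - m') t = archWeight L m t / archWeight L m' t`. [cite: BrockerTomDieck1985, Ch. II Prop. 8.1] -/
theorem archWeight_sub (m m' : InfinitePlace L → ℤ) (t : relNormOneInfUnits L⁺ L) :
    archWeight L (m - m') t = archWeight L m t / archWeight L m' t := by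
  rw [sub_eq_add_neg, archWeight_add, archWeight_neg, div_eq_mul_inv]

end Arith

/-! ## §2 The archimedean centre of the pair group and det-twists -/

section Center

/-- **the archimedean norm-one torus inside `U(1)(𝔸_{L⁺})`**: `t ↦ (t, 1)` (`relNormOneInfToIdeles` read in the
`UnitaryGroup.adelicOne` currency through `cmAdelicOneEquivRelNormOne`) — the element the central-type reading of the COR-CM package
feeds to `CMCenter`. [cite: GelbartRogawski1991, §3.1 Remark p. 457 L9–13] -/
abbrev archUnit (t : relNormOneInfUnits L⁺ L) : CMAdelicOne L :=
  (UnitaryGroup.cmAdelicOneEquivRelNormOne L).symm (relNormOneInfToIdeles L⁺ L t)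

/-- underlying idele of `archUnit t`: the archimedean idele `(t, 1)`. [cite: GelbartRogawski1991, §3.1 Remark p. 457 L9–13] -/
@[simp] theorem coe_archUnit (t : relNormOneInfUnits L⁺ L) :
    ((archUnit L t : CMAdelicOne L) : ideleGroup L) = infiniteIdeles L (t : (InfiniteAdeleRing L)ˣ) := rfl

/-- `archUnit` as a homomorphism `U(1)(L⁺ ⊗ ℝ) →* U(1)(𝔸_{L⁺})`. [cite: GelbartRogawski1991, §3.1 Remark p. 457 L9–13] -/
def archUnitHom : relNormOneInfUnits L⁺ L →* CMAdelicOne L :=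
  (UnitaryGroup.cmAdelicOneEquivRelNormOne L).symm.toMonoidHom.comp (relNormOneInfToIdeles L⁺ L)

/-- `archUnit` is continuous. [cite: GelbartRogawski1991, §3.1 Remark p. 457 L9–13] -/
theorem continuous_archUnitHom : Continuous (archUnitHom L) :=
  (UnitaryGroup.continuous_adelicOneEquivRelNormOne_symm (Fp L) L (IsCMField.complexConj L)
      (Algebra.IsQuadraticExtension.finrank_eq_two _ L) (IsCMField.complexConj_ne_one (K := L))).comp
    (continuous_relNormOneInfToIdeles L⁺ L)

/-- **the archimedean component of a character `α` of `U(1)(𝔸_{L⁺})`**: `t ↦ α(t, 1)` as a `ℂ`-valued character of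
`U(1)(L⁺ ⊗ ℝ)`. [cite: BrockerTomDieck1985, Ch. II Prop. 8.1] -/
def archUnitChar (α : CMAdelicOne L →* ℂˣ) : relNormOneInfUnits L⁺ L →* ℂ :=
  (Units.coeHom ℂ).comp (α.comp (archUnitHom L))

/-- the archimedean component of a continuous `α` is continuous. [cite: BrockerTomDieck1985, Ch. II Prop. 8.1] -/
theorem continuous_archUnitChar {α : CMAdelicOne L →* ℂˣ} (hα : Continuous α) : Continuous (archUnitChar L α) :=
  Units.continuous_val.comp (hα.comp (continuous_archUnitHom L))

/-- **every continuous `α` has an archimedean type**: `α(t, 1) = archWeight L a t` for a (unique) `a`.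
[cite: BrockerTomDieck1985, Ch. II Prop. 8.1] -/
theorem exists_archUnitChar_eq_archWeight {α : CMAdelicOne L →* ℂˣ} (hα : Continuous α) :
    ∃ a : InfinitePlace L → ℤ, ∀ t, ((α (archUnit L t) : ℂˣ) : ℂ) = archWeight L a t := by
  obtain ⟨a, ha, -⟩ := existsUnique_archWeight_eq L (archUnitChar L α) (continuous_archUnitChar L hα)
  exact ⟨a, fun t => (DFunLike.congr_fun ha t).symm⟩

variable {N' n' : ℕ} (e₁ : Fin N' × Fin 1 ≃ Fin n')
  (dV₁ : Fin N' → L) (hdV₁ : ∀ i, IsCMField.complexConj L (dV₁ i) = dV₁ i) (hdV₁0 : ∀ i, dV₁ i ≠ 0)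
  (JW : Matrix (Fin 1) (Fin 1) L)

/-- **`det ((u · 1_V) ⊗ 1) = u ^ N`** on the pair group `U(diag dV ⊗ J_W)(𝔸_{L⁺})`: the pair determinant of the central element
`(u · 1_V, 1)`. [cite: GelbartRogawski1991, §3.1 Remark p. 457 L9–13] -/
theorem pairDet_pairMap_center (hd : (Matrix.reindex e₁ e₁ (Matrix.diagonal dV₁ ⊗ₖ JW)).det ≠ 0) (u : CMAdelicOne L) :
    pairDet (Fp L) L (IsCMField.complexConj L) N' 1 e₁ (Matrix.diagonal dV₁) JW hd
        (pairMap (Fp L) L (IsCMField.complexConj L) N' 1 (Matrix.diagonal dV₁) JW (CMCenter L dV₁ u, 1)) =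
      u ^ N' := by
  apply Subtype.ext
  apply Units.ext
  rw [coe_coe_pairDet, pairMap_apply, map_one, mul_one, UnitaryGroup.coe_adelicInl, UnitaryGroup.coe_adelicCenter,
    Matrix.smul_kronecker, Matrix.one_kronecker_one, Matrix.det_smul, Matrix.det_one, mul_one, Fintype.card_prod,
    Fintype.card_fin, Fintype.card_fin, mul_one, SubgroupClass.coe_pow, Units.val_pow_eq_pow_val]

variable {TV : Matrix (Fin N') (Fin N') (Fp L)} {TW : Matrix (Fin 1) (Fin 1) (Fp L)}

/-- **the centre under a det-twist**: `ω((s ⊗ (α ∘ det))(u · 1_V, 1)) Φ = α(u)^N • ω(s(u · 1_V, 1)) Φ`.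
[cite: GelbartRogawski1991, §3.1 Remark p. 457 L4–13] -/
theorem pairRep_twist_pairDet_center (hd : (Matrix.reindex e₁ e₁ (Matrix.diagonal dV₁ ⊗ₖ JW)).det ≠ 0)
    (s : UnitaryGroup.adelicPair (Fp L) L (IsCMField.complexConj L) N' 1 (Matrix.diagonal dV₁) JW →*
      adelicMpCont (Fp L) (Fin n') (adelicGram (Fp L) e₁ TV TW))
    (α : CMAdelicOne L →* ℂˣ) (u : CMAdelicOne L) (Φ : piSchwartzBruhat (Fp L) (Fin n')) :
    pairRep (Fp L) L (IsCMField.complexConj L) N' 1 e₁ (Matrix.diagonal dV₁) JW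
        (adelicMpCont.twist (Fp L) (Fin n') (adelicGram (Fp L) e₁ TV TW) s
          (α.comp (pairDet (Fp L) L (IsCMField.complexConj L) N' 1 e₁ (Matrix.diagonal dV₁) JW hd)))
        (CMCenter L dV₁ u, 1) Φ =
      (((α u : ℂˣ) : ℂ) ^ N') •
        pairRep (Fp L) L (IsCMField.complexConj L) N' 1 e₁ (Matrix.diagonal dV₁) JW s (CMCenter L dV₁ u, 1) Φ := by
  rw [pairRep_twist_apply, MonoidHom.comp_apply, pairDet_pairMap_center, map_pow, Units.val_pow_eq_pow_val]

end Center

/-! ## §3 Rigidity along a central-type fibre -/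

section Rigidity

variable {N' n' : ℕ} (e₁ : Fin N' × Fin 1 ≃ Fin n')
  (dV₁ : Fin N' → L) (hdV₁ : ∀ i, IsCMField.complexConj L (dV₁ i) = dV₁ i) (hdV₁0 : ∀ i, dV₁ i ≠ 0)
  (TW : Matrix (Fin 1) (Fin 1) (Fp L)) (hW : TW.IsSymm) (hWd : IsUnit TW.det) (JW : Matrix (Fin 1) (Fin 1) L)
  (hJW : JW = TW.map (algebraMap (Fp L) L))
  (hA : CentralCharFactorsThroughDet (Fp L) L (IsCMField.complexConj L) N' 1 e₁ (Matrix.diagonal dV₁) JW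
    (det_reindex_kronecker_diagonal_line_ne_zero L e₁ dV₁ hdV₁0 TW hWd JW hJW))
  (χ₀ : HeckeCharacter L) (hχ₀u : χ₀.IsUnitary) (hχ₀s : IsSplittingChar L 1 χ₀)
  {s : UnitaryGroup.adelicPair (Fp L) L (IsCMField.complexConj L) N' 1 (Matrix.diagonal dV₁) JW →*
    adelicMpCont (Fp L) (Fin n') (adelicGram (Fp L) e₁ (realDiagonal L dV₁ hdV₁) TW)}
  (hsc : Continuous s)
  (hs : (splittingDatum (Fp L) L (IsCMField.complexConj L) N' 1 e₁ (Matrix.diagonal dV₁) JW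
      (complexConj_imagUnit L) (imagUnit_ne_zero L) (imagUnit_mul_self L) (realDiagonal_isSymm L dV₁ hdV₁) hW
      (isUnit_det_realDiagonal L dV₁ hdV₁ hdV₁0) hWd (realDiagonal_map L dV₁ hdV₁).symm hJW).IsCompatible s)
  {Φ₀ : piSchwartzBruhat (Fp L) (Fin n')} (hΦ₀ : Φ₀ ≠ 0)

include hdV₁0 hA hsc hs hΦ₀ in
set_option maxHeartbeats 2000000 in
-- (the statement carries the `splittingDatum` telescope of `exists_eq_chiSplittingLine_of_isCompatible`; same budget)
/-- **RIGIDITY OF THE ARCHIMEDEAN TYPE ALONG A CENTRAL-TYPE FIBRE.**  Line datum over `(diag dV, J_W)` as in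
`exists_eq_chiSplittingLine_of_isCompatible` (modulo the displayed predicate `hA`); base point `χ₀`; a CONTINUOUS compatible `s`.
If on some `Φ₀ ≠ 0` the archimedean centre `(t · 1_V, 1)`, `t ∈ U(1)(L⁺ ⊗ ℝ)`, acts through `ι_{χ₀}` by `archWeight L m₀` and
through `s` by `archWeight L m`, then `s = ι_{χ₀ · α̃}` for a continuous unitary automorphic `α` whose archimedean component is
`archWeight L a` with `N • a = m − m₀` (`s = ι_{χ₀} ⊗ (α ∘ det)` and `det (t · 1_V) = t^N`).
[cite: GelbartRogawski1991, §3.1 Remark p. 457 L4–13] [cite: Liu2021, App. D §D.1 Step 2 (l. 5219)] -/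
theorem exists_eq_chiSplittingLine_archType_of_center {m₀ m : InfinitePlace L → ℤ}
    (h₀ : ∀ t, pairRep (Fp L) L (IsCMField.complexConj L) N' 1 e₁ (Matrix.diagonal dV₁) JW
        (chiSplittingLine L e₁ dV₁ hdV₁ hdV₁0 χ₀ hχ₀u hχ₀s TW hWd JW hJW) (CMCenter L dV₁ (archUnit L t), 1) Φ₀ =
      archWeight L m₀ t • Φ₀)
    (h : ∀ t, pairRep (Fp L) L (IsCMField.complexConj L) N' 1 e₁ (Matrix.diagonal dV₁) JW s
        (CMCenter L dV₁ (archUnit L t), 1) Φ₀ = archWeight L m t • Φ₀) :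
    ∃ (α : CMAdelicOne L →* ℂˣ) (hα : Continuous α)
      (hαrat : ∀ u : CMAdelicOne L, (u : ideleGroup L) ∈ principalIdeles L → α u = 1)
      (hαu : ∀ u, ‖((α u : ℂˣ) : ℂ)‖ = 1) (a : InfinitePlace L → ℤ),
      s = chiSplittingLine L e₁ dV₁ hdV₁ hdV₁0 (χ₀ * ratioHecke L α hα hαrat) (isUnitary_mul_ratioHecke L hχ₀u hα hαrat hαu)
            ((isSplittingChar_mul_ratioHecke_iff L 1 χ₀ hα hαrat).2 hχ₀s) TW hWd JW hJW ∧
        (∀ t, ((α (archUnit L t) : ℂˣ) : ℂ) = archWeight L a t) ∧ N' • a = m - m₀ := by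
  obtain ⟨α, hα, hαrat, hαu, hsα⟩ := exists_eq_chiSplittingLine_of_isCompatible L e₁ dV₁ hdV₁ hdV₁0 TW hW hWd JW hJW hA
    χ₀ hχ₀u hχ₀s hsc hs
  obtain ⟨a, ha⟩ := exists_archUnitChar_eq_archWeight L hα
  refine ⟨α, hα, hαrat, hαu, a, hsα, ha, archWeight_injective (MonoidHom.ext fun t => ?_)⟩
  -- compare the two central characters on `Φ₀`
  have key : archWeight L m t • Φ₀ = (archWeight L a t ^ N' * archWeight L m₀ t) • Φ₀ := by
    rw [← h t, hsα, chiSplittingLine_mul_ratioHecke L e₁ dV₁ hdV₁ hdV₁0 χ₀ hχ₀u hχ₀s hα hαrat hαu TW hWd JW hJW,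
      pairRep_twist_pairDet_center, h₀ t, smul_smul, ha]
  have hsc' : archWeight L m t = archWeight L a t ^ N' * archWeight L m₀ t := smul_left_injective ℂ hΦ₀ key
  have hne : archWeight L m₀ t ≠ 0 := norm_ne_zero_iff.mp (by rw [norm_archWeight]; exact one_ne_zero)
  rw [archWeight_nsmul, archWeight_sub, hsc', mul_div_assoc, div_self hne, mul_one]

include hdV₁0 hA hsc hs hΦ₀ in
set_option maxHeartbeats 2000000 in
/-- **EQUAL central characters force `α_∞ = 1`**: in the situation of `exists_eq_chiSplittingLine_archType_of_center` with
`m = m₀` (and `N ≠ 0`), `s = ι_{χ₀ · α̃}` with the twisting character `α` TRIVIAL on the connected archimedean torus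
`U(1)(L⁺ ⊗ ℝ)` (`N • a = 0 ⇒ a = 0`).  Hence `α̃ = ratioHecke α` has trivial archimedean component and `χ₀ · α̃` has the
archimedean type of `χ₀` — that reading (Hecke-character ∕ idele-class currency, weight one, CM type) is the sequel's, through
the arch-type dictionary for `ratioHecke` of `UnitaryGroupAdelicCharactersArchType`.
[cite: GelbartRogawski1991, §3.1 Remark p. 457 L4–13] [cite: BrockerTomDieck1985, Ch. II Prop. 8.1] -/
theorem exists_eq_chiSplittingLine_archTrivial_of_center_eq [NeZero N'] {m : InfinitePlace L → ℤ}
    (h₀ : ∀ t, pairRep (Fp L) L (IsCMField.complexConj L) N' 1 e₁ (Matrix.diagonal dV₁) JW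
        (chiSplittingLine L e₁ dV₁ hdV₁ hdV₁0 χ₀ hχ₀u hχ₀s TW hWd JW hJW) (CMCenter L dV₁ (archUnit L t), 1) Φ₀ =
      archWeight L m t • Φ₀)
    (h : ∀ t, pairRep (Fp L) L (IsCMField.complexConj L) N' 1 e₁ (Matrix.diagonal dV₁) JW s
        (CMCenter L dV₁ (archUnit L t), 1) Φ₀ = archWeight L m t • Φ₀) :
    ∃ (α : CMAdelicOne L →* ℂˣ) (hα : Continuous α)
      (hαrat : ∀ u : CMAdelicOne L, (u : ideleGroup L) ∈ principalIdeles L → α u = 1)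
      (hαu : ∀ u, ‖((α u : ℂˣ) : ℂ)‖ = 1),
      s = chiSplittingLine L e₁ dV₁ hdV₁ hdV₁0 (χ₀ * ratioHecke L α hα hαrat) (isUnitary_mul_ratioHecke L hχ₀u hα hαrat hαu)
            ((isSplittingChar_mul_ratioHecke_iff L 1 χ₀ hα hαrat).2 hχ₀s) TW hWd JW hJW ∧
        ∀ t, α (archUnit L t) = 1 := by
  obtain ⟨α, hα, hαrat, hαu, a, hsα, ha, hNa⟩ := exists_eq_chiSplittingLine_archType_of_center L e₁ dV₁ hdV₁ hdV₁0 TW hW hWd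
    JW hJW hA χ₀ hχ₀u hχ₀s hsc hs hΦ₀ h₀ h
  rw [sub_self, smul_eq_zero_iff_right (NeZero.ne N')] at hNa
  subst hNa
  exact ⟨α, hα, hαrat, hαu, hsα, fun t => Units.ext (by rw [ha t, archWeight_zero, Units.val_one])⟩

end Rigidity

/-! ## §4 The same at the CM datum of record (`cmSplittingDatum`, `W = ⟨dW 0⟩`) — one call for the COR-CM pin -/

section CM

variable {N' n' : ℕ} (e₁ : Fin N' × Fin 1 ≃ Fin n')
  (dV₁ : Fin N' → L) (hdV₁ : ∀ i, IsCMField.complexConj L (dV₁ i) = dV₁ i) (hdV₁0 : ∀ i, dV₁ i ≠ 0)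
  (dW : Fin 1 → L) (hdW : ∀ i, IsCMField.complexConj L (dW i) = dW i) (hdW0 : ∀ i, dW i ≠ 0)

include hdW0 in
set_option maxHeartbeats 2000000 in
/-- **EQUAL central characters force `α_∞ = 1`, CM currency**: `exists_eq_chiSplittingLine_archTrivial_of_center_eq` at the tree's CM datum
`cmSplittingDatum L e₁ dV dW` (`T_W := realDiagonal dW`, `J_W := diagonal dW`) — the shape `IsCompatible` has in the COR-CM package's index
(`LiuIndex.IsCompatAtScalar`, `dV := frameD V`, `dW := vec a`). [cite: GelbartRogawski1991, §3.1 Remark p. 457 L4–13] [cite: Liu2021, App. D §D.1 Step 2 (l. 5219)] -/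
theorem exists_eq_chiSplittingLine_archTrivial_of_center_eq_cm [NeZero N']
    (hA : CentralCharFactorsThroughDet (Fp L) L (IsCMField.complexConj L) N' 1 e₁ (Matrix.diagonal dV₁) (Matrix.diagonal dW)
      (det_reindex_kronecker_diagonal_line_ne_zero L e₁ dV₁ hdV₁0 (realDiagonal L dW hdW)
        (isUnit_det_realDiagonal L dW hdW hdW0) (Matrix.diagonal dW) (realDiagonal_map L dW hdW).symm))
    (χ₀ : HeckeCharacter L) (hχ₀u : χ₀.IsUnitary) (hχ₀s : IsSplittingChar L 1 χ₀)
    {s : UnitaryGroup.adelicPair (Fp L) L (IsCMField.complexConj L) N' 1 (Matrix.diagonal dV₁) (Matrix.diagonal dW) →*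
      adelicMpCont (Fp L) (Fin n') (adelicGram (Fp L) e₁ (realDiagonal L dV₁ hdV₁) (realDiagonal L dW hdW))}
    (hsc : Continuous s) (hs : (cmSplittingDatum L e₁ dV₁ hdV₁ hdV₁0 dW hdW hdW0).IsCompatible s)
    {Φ₀ : piSchwartzBruhat (Fp L) (Fin n')} (hΦ₀ : Φ₀ ≠ 0) {m : InfinitePlace L → ℤ}
    (h₀ : ∀ t, pairRep (Fp L) L (IsCMField.complexConj L) N' 1 e₁ (Matrix.diagonal dV₁) (Matrix.diagonal dW)
        (chiSplittingLine L e₁ dV₁ hdV₁ hdV₁0 χ₀ hχ₀u hχ₀s (realDiagonal L dW hdW) (isUnit_det_realDiagonal L dW hdW hdW0)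
          (Matrix.diagonal dW) (realDiagonal_map L dW hdW).symm) (CMCenter L dV₁ (archUnit L t), 1) Φ₀ =
      archWeight L m t • Φ₀)
    (h : ∀ t, pairRep (Fp L) L (IsCMField.complexConj L) N' 1 e₁ (Matrix.diagonal dV₁) (Matrix.diagonal dW) s
        (CMCenter L dV₁ (archUnit L t), 1) Φ₀ = archWeight L m t • Φ₀) :
    ∃ (α : CMAdelicOne L →* ℂˣ) (hα : Continuous α)
      (hαrat : ∀ u : CMAdelicOne L, (u : ideleGroup L) ∈ principalIdeles L → α u = 1)
      (hαu : ∀ u, ‖((α u : ℂˣ) : ℂ)‖ = 1),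
      s = chiSplittingLine L e₁ dV₁ hdV₁ hdV₁0 (χ₀ * ratioHecke L α hα hαrat) (isUnitary_mul_ratioHecke L hχ₀u hα hαrat hαu)
            ((isSplittingChar_mul_ratioHecke_iff L 1 χ₀ hα hαrat).2 hχ₀s) (realDiagonal L dW hdW)
            (isUnit_det_realDiagonal L dW hdW hdW0) (Matrix.diagonal dW) (realDiagonal_map L dW hdW).symm ∧
        ∀ t, α (archUnit L t) = 1 :=
  exists_eq_chiSplittingLine_archTrivial_of_center_eq L e₁ dV₁ hdV₁ hdV₁0 (realDiagonal L dW hdW) (realDiagonal_isSymm L dW hdW)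
    (isUnit_det_realDiagonal L dW hdW hdW0) (Matrix.diagonal dW) (realDiagonal_map L dW hdW).symm hA χ₀ hχ₀u hχ₀s hsc hs hΦ₀ h₀ h

end CM


end Literature.NumberTheory.Automorphic.Liu2021.Def411WeilCarriersDoubling

end
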